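import Summits.BirchSwinnertonDyer.BirchSwinnertonDyer.Theorems.QuadraticBranchSignedControlPlusEtaNonsurjKatoClauseThreeIdle
import Summits.BirchSwinnertonDyer.Rank1Residual.Additive.FouquetWanLocus
import Literature.NumberTheory.EllipticCurves.BSDSelmerPConverseRamifiedProofs
import Literature.NumberTheory.EllipticCurves.OpenImageMazurTwistProofs
import Literature.NumberTheory.EllipticCurves.VariableChangePointsMap
import HarnessLib

/-!
# Route `QuadraticBranchSignedControl` (rung K8, cell `bsd-potss`): crux stmt-BirchSwinnertonDyer-19606
# `PlusEtaMainConjectureNonsurj` — THE ADDITIVE PARTNER `W` (`C • W^{(p*)} = V`) OF A ROW IS SMALL-IMAGE TOO: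
# no transvection on `W[p]`, Kato 13.4 (3) idle for `T_pW`, no Steinberg handle for `W`

WHAT. On rung K8 the Iwasawa-theoretic objects of a Gss2 row live on BOTH members of the pair: the good supersingular
twist `V` (the `η`-signed Selmer group of the crux) and its ADDITIVE partner `W`, `C • W^{(p*)} = V`
(`W = V ⊗ η` carries Kobayashi's `η`-projected zeta element; Kato's Thm. 13.4 is applied to `T = T_pW`, cf.
`Kato2004.exists_finrank_coker_eq_one_twist_of_not_hasCM`, k8q-c2x g5). The files `…CartanField`,
`…KatoClauseThreeIdle`, `…SteinbergHandleIdle` proved the structural no-gos for the ROW `V` (`Im ρ̄_{V,p} = C_ns⁺(p)`).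
This file transports them to the PARTNER: `W[p] ≅ V[p] ⊗ η̄` (Silverman X.5 Cor. 5.4: `E^{(d)} ≅ E` over `ℚ(√d)`, the
cocycle being `χ_d = ±1`), and `C_ns⁺(ε)` is stable under `M ↦ −M`, so `Im ρ̄_{W,p} ⊆ C_ns⁺(ε)` as well:

* §1 `neg_mem_nonsplitCartanNormalizer`; `hasNonsplitCartanModPImage_of_addEquiv_signed` (transport of
  `HasNonsplitCartanModPImage` along an additive `W'(ℚ̄) ≃+ W(ℚ̄)` that is `Γ_ℚ`-equivariant UP TO SIGN);
  `hasNonsplitCartanModPImage_partner` (**`C • W^{(p*)} = V` and `Im ρ̄_{V,p} ⊆ C_ns⁺` ⟹ `Im ρ̄_{W,p} ⊆ C_ns⁺`**).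
* §2 for the partner `W` of a row of crux 19606 (`V` globally minimal, `p ≥ 5` good, `a_p(V) = 0`, tower of `V` not
  onto): `smul_eq_self_of_transvection_partner` (no transvection on `W[p]`), **`not_exists_katoClauseThree_partner`**
  (the hypothesis of clause (3) of `Kato2004.thm13_4_lengthAt_fineSelmerDual_le_of_isEulerSystemClass` is unsatisfiable
  for `T = T_pW` — the object K8 feeds to Kato), `dvd_padicValInt_minimalDiscriminant_of_hasMultiplicativeReduction_of_image`
  (image form of the no-Steinberg theorem) and **`not_fwNonsplitRam_partner`** (`¬ FWNonsplitRam W p`).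

HONEST FRAMING (cell `bsd-potss`, run/shared/lean/pub/bsd-potss/; FULL-BSD rank ≤ 1 programme): TOOL THEOREMS ONLY (no
definition, no named fact, no `sorry`, axioms standard). Negative structural statements about the applicability of
two integral handles; nothing is refuted or booked; crux 19606 stays OPEN; `BSD(W, p)` is claimed for no pair. Seat
`bsd-potss-k8eta-c2` g9 (prover), `--supports stmt-BirchSwinnertonDyer-19606`.

References: [SilvermanAEC2009] X.5 Cor. 5.4; [Kato2004Asterisque] Thm. 13.4 (3) (p. 226); [SilvermanATAEC1994] V.4–V.5;
[Serre1972] §2.2; O. Fouquet, X. Wan, arXiv:2107.13726, Thm. 1.1.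
-/

set_option autoImplicit false
set_option linter.dupNamespace false

noncomputable section

open scoped Classical NNReal

open NumberField IsDedekindDomain Field WeierstrassCurve Literature.NumberTheory.EllipticCurves
  Literature.NumberTheory.SerreUniformity Summit.BirchSwinnertonDyer.Rank1Residual.Additive
  Literature.NumberTheory.EllipticCurves.Kato2004

namespace Summit.BirchSwinnertonDyer.BirchSwinnertonDyer.Theorems.EtaCartanField

variable {p : ℕ} [hp : Fact p.Prime]

/-! ## §1 Transport of the small image along a signed-equivariant isomorphism -/

/-- `C_ns⁺(ε)` is stable under `M ↦ −M` (`(a, b) ↦ (−a, −b)`). [cite: Serre1972, §2.2] -/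
theorem neg_mem_nonsplitCartanNormalizer {ε : ZMod p} {M : Matrix (Fin 2) (Fin 2) (ZMod p)}
    (hM : M ∈ nonsplitCartanNormalizer ε) : -M ∈ nonsplitCartanNormalizer ε := by
  obtain ⟨a, b, hab, rfl | rfl⟩ := hM
  · refine ⟨-a, -b, fun h => hab ?_, Or.inl ?_⟩
    · simp only [Prod.mk.injEq, neg_eq_zero] at h
      rw [h.1, h.2]
    · ext i j; fin_cases i <;> fin_cases j <;> simp
  · refine ⟨-a, -b, fun h => hab ?_, Or.inr ?_⟩
    · simp only [Prod.mk.injEq, neg_eq_zero] at h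
      rw [h.1, h.2]
    · ext i j; fin_cases i <;> fin_cases j <;> simp

/-- **Transport of `HasNonsplitCartanModPImage` along an additive isomorphism `W'(ℚ̄) ≃+ W(ℚ̄)` which is
`Γ_ℚ`-equivariant UP TO SIGN** (`f(σP) = ±σ f(P)`, the sign depending on `σ` only — the shape of the untwisting
`E^{(d)} ≅ E`, Silverman X.5 Cor. 5.4): the frame `e ∘ f` of `W'[p]` has matrices `±ρ̄_W(σ) ∈ C_ns⁺(ε)`.
[cite: SilvermanAEC2009, X.5 Cor. 5.4] -/
theorem hasNonsplitCartanModPImage_of_addEquiv_signed {W W' : WeierstrassCurve ℚ}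
    (f : W'.geomPoints ≃+ W.geomPoints)
    (hf : ∀ σ : absoluteGaloisGroup ℚ,
      (∀ P, f (σ • P) = σ • f P) ∨ (∀ P, f (σ • P) = -(σ • f P)))
    (h : HasNonsplitCartanModPImage W p) : HasNonsplitCartanModPImage W' p := by
  obtain ⟨e, ε, hε, himg⟩ := h
  -- restriction of `f` to the `p`-torsion (as in `isTorsionGaloisRep_twist_of_addEquiv_signed`)
  have htor : ∀ {P : geomPoints W'}, P ∈ geomTorsion W' p ↔ f P ∈ geomTorsion W p := by
    intro P
    rw [geomTorsion, geomTorsion, AddSubgroup.torsionBy.nsmul_iff, AddSubgroup.torsionBy.nsmul_iff,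
      ← map_nsmul, AddEquiv.map_eq_zero_iff]
  let fₚ : geomTorsion W' p ≃+ geomTorsion W p :=
    { toFun := fun P ↦ ⟨f P, htor.mp P.2⟩
      invFun := fun Q ↦ ⟨f.symm Q, by rw [htor, f.apply_symm_apply]; exact Q.2⟩
      left_inv := fun P ↦ Subtype.ext (f.symm_apply_apply _)
      right_inv := fun Q ↦ Subtype.ext (f.apply_symm_apply _)
      map_add' := fun P Q ↦ Subtype.ext (by
        change f ((P : geomPoints W') + Q) = f P + f Q
        exact map_add f _ _) }
  have hfₚ : ∀ P : geomTorsion W' p, ((fₚ P : geomTorsion W p) : geomPoints W) = f P := fun _ ↦ rfl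
  refine ⟨fₚ.trans e, ε, hε, fun σ => ?_⟩
  obtain ⟨M, hM, hMσ⟩ := himg σ
  rcases hf σ with hP | hP
  · refine ⟨M, hM, fun P => ?_⟩
    have h1 : fₚ (σ • P) = σ • fₚ P := Subtype.ext (by
      rw [AddSubgroup.torsionBy.coe_smul, hfₚ, hfₚ, AddSubgroup.torsionBy.coe_smul, hP])
    rw [AddEquiv.trans_apply, AddEquiv.trans_apply, h1, hMσ]
  · refine ⟨-M, neg_mem_nonsplitCartanNormalizer hM, fun P => ?_⟩
    have h1 : fₚ (σ • P) = -(σ • fₚ P) := Subtype.ext (by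
      rw [AddSubgroup.coe_neg, AddSubgroup.torsionBy.coe_smul, hfₚ, hfₚ, AddSubgroup.torsionBy.coe_smul, hP])
    rw [AddEquiv.trans_apply, AddEquiv.trans_apply, h1, map_neg, hMσ, Matrix.neg_mulVec]

/-- **Transport along a change of variables** (`Γ_ℚ`-equivariant isomorphism `X(ℚ̄) ≃+ (C • X)(ℚ̄)`). [folklore] -/
theorem hasNonsplitCartanModPImage_of_smul_eq {X Y : WeierstrassCurve ℚ} (C : VariableChange ℚ) (hXY : C • X = Y)
    (h : HasNonsplitCartanModPImage Y p) : HasNonsplitCartanModPImage X p := by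
  subst hXY
  let g : X.geomPoints ≃+ (C • X).geomPoints := VariableChange.pointEquivBaseChange X C (AlgebraicClosure ℚ)
  have hg : ∀ (τ : absoluteGaloisGroup ℚ) (P : X.geomPoints), g (τ • P) = τ • g P := fun τ P ↦
    VariableChange.pointEquivBaseChange_map_algEquiv X C (absoluteGaloisGroup.toAlgEquiv ℚ τ) P
  exact hasNonsplitCartanModPImage_of_addEquiv_signed g (fun σ => Or.inl (hg σ)) h

/-- **The additive partner of a small-image row is small-image**: if `C • W^{(p*)} = V` (`p` odd) and
`Im ρ̄_{V,p} ⊆ C_ns⁺(ε)`, then `Im ρ̄_{W,p} ⊆ C_ns⁺(ε)` (`W ≅ W^{(p*)}` over `ℚ(√p*)` with cocycle `±1`, then the change of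
variables `C`). [cite: SilvermanAEC2009, X.5 Cor. 5.4] -/
theorem hasNonsplitCartanModPImage_partner {V W : WeierstrassCurve ℚ} (C : VariableChange ℚ)
    (hCV : C • W.quadraticTwist (((-1 : ℚ) ^ (p / 2)) * p) = V) (h : HasNonsplitCartanModPImage V p) :
    HasNonsplitCartanModPImage W p := by
  have hprime : p.Prime := Fact.out
  set d : ℚ := ((-1 : ℚ) ^ (p / 2)) * p with hd
  have hd0 : d ≠ 0 := mul_ne_zero (pow_ne_zero _ (by norm_num)) (Nat.cast_ne_zero.mpr hprime.ne_zero)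
  -- `W^{(d)}` is small-image (change of variables), and `W ≅ W^{(d)}` up to sign
  have hWd : HasNonsplitCartanModPImage (W.quadraticTwist d) p := hasNonsplitCartanModPImage_of_smul_eq C hCV h
  obtain ⟨f, hf⟩ := exists_addEquiv_geomPoints_quadraticTwist_signed W hd0
  -- `f : W^{(d)}(ℚ̄) ≃+ W(ℚ̄)`, signed-equivariant; use its inverse
  refine hasNonsplitCartanModPImage_of_addEquiv_signed f.symm (fun σ => ?_) hWd
  rcases hf σ with hP | hP
  · left
    intro Q
    apply f.injective
    rw [f.apply_symm_apply, hP, f.apply_symm_apply]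
  · right
    intro Q
    apply f.injective
    rw [f.apply_symm_apply, map_neg, hP, f.apply_symm_apply, neg_neg]

/-! ## §2 The partner of a row of crux 19606 -/

/-- **No Steinberg handle, image form**: for `W/ℚ` globally minimal with `Im ρ̄_{W,p} ⊆ C_ns⁺(ε)` (`p ≠ 2`), every
multiplicative prime `ℓ ≠ p` has `p ∣ v_ℓ(Δ_min(W))` (`ρ̄_{W,p}` unramified at `ℓ`). Same proof as the row form of
`…SteinbergHandleIdle`. [cite: SilvermanATAEC1994, V.4–V.5 and Exercise 5.13 (b)] [cite: Serre1972, §2.2] -/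
theorem dvd_padicValInt_minimalDiscriminant_of_hasMultiplicativeReduction_of_image (W : WeierstrassCurve ℚ)
    [W.IsElliptic] [W.IsGloballyMinimal] (p : ℕ) [Fact p.Prime] (hp2 : p ≠ 2) (h : HasNonsplitCartanModPImage W p)
    (ℓ : ℕ) [hℓ : Fact ℓ.Prime] (hℓp : ℓ ≠ p) (hmult : W.HasMultiplicativeReductionAtPrime ℓ) :
    p ∣ padicValInt ℓ W.minimalDiscriminantInt := by
  have hpr : p.Prime := Fact.out
  by_contra hdiv
  set v : HeightOneSpectrum (𝓞 ℚ) :=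
    (Rat.HeightOneSpectrum.primesEquiv (R := 𝓞 ℚ)).symm ⟨ℓ, hℓ.out⟩ with hvdef
  have hv : Rat.HeightOneSpectrum.primesEquiv v = ⟨ℓ, hℓ.out⟩ := Equiv.apply_symm_apply _ _
  have hvℓ : (Rat.HeightOneSpectrum.primesEquiv v : ℕ) = ℓ := congrArg Subtype.val hv
  obtain ⟨w, hw⟩ := v.exists_spectralValuation
  obtain ⟨𝔐, h𝔐⟩ := v.localPrimesAbove_nonempty
  have hmult_v : haveI := Fact.mk (Rat.HeightOneSpectrum.primesEquiv v).2;
      W.HasMultiplicativeReductionAtPrime (Rat.HeightOneSpectrum.primesEquiv v) := by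
    have key : ∀ (q : ℕ) (hq : Fact q.Prime), q = ℓ →
        @WeierstrassCurve.HasMultiplicativeReductionAtPrime W q hq := by
      rintro q hq rfl; exact hmult
    exact key _ _ hvℓ
  have hram_v : ¬ p ∣ padicValNat (Rat.HeightOneSpectrum.primesEquiv v) W.minimalDiscriminantInt.natAbs := by
    rw [hvℓ]; exact hdiv
  have hℓp' : (Rat.HeightOneSpectrum.primesEquiv v : ℕ) ≠ p := by rw [hvℓ]; exact hℓp
  have hloc := W.exists_inertia_smul_ne_of_hasMultiplicativeReductionAtPrime v hpr hℓp' hmult_v hram_v hw h𝔐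
  have hmultAt : W.HasMultiplicativeReductionAt v :=
    (WeierstrassCurve.hasMultiplicativeReductionAtPrime_iff_hasMultiplicativeReductionAt_ringOfIntegers W v).mp
      hmult_v
  have hpv : (p : 𝓞 ℚ) ∉ v.asIdeal := by
    intro hmem
    have hv' := (natCast_mem_asIdeal_iff_eq_primesEquiv_symm v hpr).mp hmem
    apply hℓp'
    rw [hv', Equiv.apply_symm_apply]
  have hU := W.exists_unipotent_of_hasMultiplicativeReductionAt hmultAt hpr hpv (le_refl 1) hw h𝔐 hloc
  rw [pow_one] at hU
  obtain ⟨σ, hσ, Q, -, hσQ⟩ := hU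
  refine hσQ (smul_eq_self_of_transvection hp2 h (σ := σ) (fun P => ?_) Q)
  have h1 := hσ P
  rw [smul_sub] at h1
  exact sub_eq_sub_iff_add_eq_add.mp h1

section Partner

variable (V : WeierstrassCurve ℚ) [V.IsElliptic] [V.IsGloballyMinimal] (W : WeierstrassCurve ℚ) [W.IsElliptic]
  [W.IsGloballyMinimal] (C : VariableChange ℚ) (p : ℕ) [Fact p.Prime]

omit [W.IsElliptic] [W.IsGloballyMinimal] in
/-- **The partner of a row of crux 19606 is small-image**: `C • W^{(p*)} = V`, `V` glob. min., `p ≥ 5` good for `V`,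
`a_p(V) = 0`, `p`-adic tower of `V` not onto ⟹ `Im ρ̄_{W,p} ⊆ C_ns⁺(p)`. [cite: SilvermanAEC2009, X.5 Cor. 5.4]
[cite: Serre1972, §1.11 Prop. 12, §2.2] -/
theorem hasNonsplitCartanModPImage_partner_of_row (hp5 : 5 ≤ p)
    (hCV : C • W.quadraticTwist ((-1) ^ (p / 2) * p) = V) (hgood : V.HasGoodReductionAtPrime p)
    (hap : V.frobeniusTrace p = 0) (hns : ¬ ∀ m : ℕ, V.HasSurjectiveModNGaloisRep (p ^ m : ℕ)) :
    HasNonsplitCartanModPImage W p :=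
  hasNonsplitCartanModPImage_partner C hCV
    (hasModPImageEqNonsplitCartanNormalizer_of_row V p hp5 hgood hap hns).hasNonsplitCartanModPImage

omit [W.IsElliptic] [W.IsGloballyMinimal] in
/-- **No transvection on the partner's `p`-torsion.** [cite: Serre1972, §2.2] -/
theorem smul_eq_self_of_transvection_partner (hp5 : 5 ≤ p)
    (hCV : C • W.quadraticTwist ((-1) ^ (p / 2) * p) = V) (hgood : V.HasGoodReductionAtPrime p)
    (hap : V.frobeniusTrace p = 0) (hns : ¬ ∀ m : ℕ, V.HasSurjectiveModNGaloisRep (p ^ m : ℕ))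
    {σ : absoluteGaloisGroup ℚ} (hσ : ∀ P : W.geomTorsion p, σ • (σ • P) + P = σ • P + σ • P) :
    ∀ P : W.geomTorsion p, σ • P = P :=
  smul_eq_self_of_transvection (by omega) (hasNonsplitCartanModPImage_partner_of_row V W C p hp5 hCV hgood hap hns) hσ

omit [W.IsGloballyMinimal] in
/-- **Kato's Thm. 13.4 clause (3) is idle for the partner `T = T_pW`** — the object rung K8 feeds to Kato's machine
(`W = V ⊗ η`): on every row of crux 19606 there is no `σ` fixing `μ_{p^∞}` with `T_pW/(ρ(σ) − 1)T_pW ≃ ℤ_p`.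
[cite: Kato2004Asterisque, Thm. 13.4 (3) (p. 226)] [cite: SilvermanAEC2009, X.5 Cor. 5.4] -/
theorem not_exists_katoClauseThree_partner (hp5 : 5 ≤ p)
    (hCV : C • W.quadraticTwist ((-1) ^ (p / 2) * p) = V) (hgood : V.HasGoodReductionAtPrime p)
    (hap : V.frobeniusTrace p = 0) (hns : ¬ ∀ m : ℕ, V.HasSurjectiveModNGaloisRep (p ^ m : ℕ)) :
    ¬ ∃ σ : absoluteGaloisGroup ℚ,
      (∀ (n : ℕ) (t : AlgebraicClosure ℚ), t ^ p ^ n = 1 → σ • t = t) ∧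
        Nonempty (((W.tateModule p) ⧸ LinearMap.range (W.galoisRepTate p σ - 1)) ≃ₗ[ℤ_[p]] ℤ_[p]) :=
  not_exists_katoClauseThree W (by omega) (hasNonsplitCartanModPImage_partner_of_row V W C p hp5 hCV hgood hap hns)

/-- **No Steinberg handle for the partner**: every multiplicative prime `ℓ ≠ p` of `W` has `p ∣ v_ℓ(Δ_min(W))`, so
`¬ FWNonsplitRam W p` — the Fouquet–Wan shape the K8 route uses on the tower-onto locus (crux 19242) is EMPTY on the
rows of crux 19606. [cite: SilvermanATAEC1994, V.4–V.5 and Exercise 5.13 (b)] [cite: Serre1972, §2.2] -/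
theorem not_fwNonsplitRam_partner (hp5 : 5 ≤ p) (hCV : C • W.quadraticTwist ((-1) ^ (p / 2) * p) = V)
    (hgood : V.HasGoodReductionAtPrime p) (hap : V.frobeniusTrace p = 0)
    (hns : ¬ ∀ m : ℕ, V.HasSurjectiveModNGaloisRep (p ^ m : ℕ)) : ¬ FWNonsplitRam W p := by
  rintro ⟨q, hq, hqp, hmult, -, hdiv⟩
  exact hdiv (dvd_padicValInt_minimalDiscriminant_of_hasMultiplicativeReduction_of_image W p (by omega)
    (hasNonsplitCartanModPImage_partner_of_row V W C p hp5 hCV hgood hap hns) q hqp hmult)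

end Partner

end Summit.BirchSwinnertonDyer.BirchSwinnertonDyer.Theorems.EtaCartanField

end
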